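import Literature.AlgebraicGeometry.HodgeTheory.FermatInductiveClaims
import Literature.AlgebraicGeometry.Motives.ProjectiveSpaceLinearSubspaces
import HarnessLib

/-!
# Shioda's linear subspaces on Fermat varieties (proof file of `Shioda_claim_paired`): "represents ⟹ claim", the linear sections, and the assembly

Family `hodge`, layer `Literature/AlgebraicGeometry/HodgeTheory`. PROOF FILE for the named fact
`Shioda_claim_paired` of `FermatInductiveClaims` (Aoki, J. Math. Soc.
Japan 39 (1987), Thm. 1-1 = Shioda; Ran, Compositio Math. 42 (1980) Thm. 4.9): for every character
`δ` of `X²ʳₘ` with all `δᵢ ≠ 0` which is paired (`δ ∘ σ = -δ`, `σ` a fixed-point-free involution),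
claim(δ) holds, i.e. `V(δ) ⊆ H²ʳ(X²ʳₘ(ℂ); ℂ)` consists of classes of algebraic cycles. Everything
here is PROVED; no named fact is introduced (D-0026).

The printed proof has three parts; this file proves the soft part (C), the scheme-theoretic half
of (B), and assembles the fact from the rest, stated on the tree's carriers as explicit hypotheses
(as `FermatHodgeConjectureAssembly` does for the middle degree):

* (A) **`dim V(δ) = 1`** for the characters with all `δᵢ ≠ 0`, `Σ δᵢ = 0` — Ran Prop. 1.7 (i)
  (p. 125, "with each `H_χ` 1-dimensional", from Ogus); Shioda Math. Ann. 245 §1. NOT in the tree.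
* (B) **THEOREM 1-1 (Shioda): "the linear space `L` represents `δ`"**, `L : x_{2i} + ε x_{2i+1} = 0`
  (`0 ≤ i ≤ r`), `ε = exp(π√-1/m)`, i.e. `ω_δ(L) ≠ 0` (Aoki p. 386; Ran Prop. 1.14, Cor. 4.7). In
  the tree's cycle-map-free language (`AlgebraicClasses`: a class is algebraic iff it dies on the
  complex points of the complement of a Zariski-closed subset of codimension `≥ r`) this has two
  halves: (B1) `L_{σ,ε} : xᵢ = εᵢ x_{σ i}` is a Zariski-closed subset of `ℙ²ʳ⁺¹` whose trace
  `Z_{σ,ε}` on `X²ʳₘ` has codimension `≥ r` at every point — PROVED here (`pairedLinearSubspace`,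
  `fermatLinearSection`, `le_coheight_of_mem_fermatLinearSection`: the `r + 1` forms are
  independent, the generic point of an `r`-plane of `ℙ²ʳ⁺¹` has dimension `r`
  (`Motives.exists_point_of_linearIndependent`), closed immersions do not decrease `height`, and
  `height + coheight = 2r` on the smooth `X²ʳₘ`); (B2) some class supported on `Z_{σ,ε}`
  (classically `cl(L)`, `εᵢᵐ = -1`) has `π_δ ≠ 0` — NOT in the tree (fundamental classes, the
  intersection numbers `L · g(L)` / Ran's `M_{ij}`).
* (C) **"If there exists an algebraic cycle `Z` on `Xⁿₘ` such that `ω_α(Z) ≠ 0`, then claim(α) is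
  true"** (Aoki p. 386): PROVED as `FermatCharacter.claim_of_supportedClass` — a class dying on
  `(X ∖ Z)(ℂ)`, `Z` closed of codimension `≥ r`, is algebraic by definition of
  `algebraicClasses = Nʳ H²ʳ`; `π_α` preserves algebraic classes (`eigenProjector_mem_algebraicClasses`),
  so a non-zero `π_α c` spans the line `V(α)`, granted (A) (the one-line linear algebra
  `Submodule.le_of_le_span_singleton`; the tree's `FermatCharacter.claim_of_represents` of
  `FermatInductiveClaimsProofs` is the same step for a class given in `algebraicClasses`).

Assemblies: `Shioda_claim_paired_of_represents` ((A) + (B) with an abstract support `Z`) and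
`Shioda_claim_paired_of_linearSubspace_represents` ((A) + (B2) for the concrete `Z_{σ,ε}`), with (A)
in the same form `hE1` as `Aoki1987_claim_pStandard_of_represents`; also
`FermatCharacter.claim_zero` (dimension `0`).

## What is NOT here

(A) and (B2): the `μₘⁿ⁺²`-structure of `Hⁿ(Xⁿₘ(ℂ); ℂ)` (Pham / Griffiths residues / Ogus) and the
cycle class of `L` with `ω_δ(L) ≠ 0` — the next layers of `Shioda_claim_paired_holds`.

## References

* [Aoki1987] N. Aoki, Some new algebraic cycles on Fermat varieties, J. Math. Soc. Japan 39 (1987)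
  385–396: p. 385 (CLAIM(α)), Thm. 1-1 and p. 386 ("represents ⟹ claim") (statement as vendored in
  `FermatInductiveClaims`; source requested, not held).
* [Ran1980] Z. Ran, Cycles on Fermat hypersurfaces, Compositio Math. 42 (1980) 121–142: §1
  Prop. 1.7 (i) (p. 125), Prop. 1.14 (p. 127), Cor. 4.7 and Thm. 4.9 (pp. 140–141) (text read).
* [Hartshorne1977] R. Hartshorne, Algebraic Geometry (1977), I Ex. 2.11, II Ex. 3.20.
* [Shioda1979PJA] T. Shioda, Proc. Japan Acad. 55A (1979) 111–114, §4. [HatcherAT2002] App. A.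
-/
noncomputable section

open CategoryTheory AlgebraicGeometry MvPolynomial Finset

namespace Literature.AlgebraicGeometry.HodgeTheory

open Literature.AlgebraicGeometry.Motives Literature.AlgebraicTopology.SingularHomology

variable {n m r : ℕ}

/-! ### `claim(α)` in dimension `0` -/

/-- **claim(α) holds on `X⁰ₘ`** (`r = 0`, allowed by "non-negative even integers" in Thm. 1-4): in
codimension `0` every class is algebraic (`algebraicClasses_zero`: take `Z = X`).
[cite: Aoki1987, Introduction p. 385 (CLAIM(α))] -/
theorem FermatCharacter.claim_zero (m : ℕ) (α : Fin (2 * 0 + 2) → ZMod m) :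
    FermatCharacter.Claim m 0 α := by
  change fermatEigenspace m α (2 * 0) ≤ algebraicClasses (fermatHypersurface (2 * 0) m) 0
  rw [algebraicClasses_zero]
  exact le_top

/-! ### "Represents ⟹ claim" for a class supported on a closed subset (Aoki p. 386) -/

/-- Linear algebra of "one cycle suffices": a subspace `W` contained in a line `K ∙ v` and meeting a
subspace `S` in a non-zero vector lies in `S` (`W ⊆ K ∙ v = K ∙ w ⊆ S`). [folklore] -/
theorem Submodule.le_of_le_span_singleton {K V : Type*} [DivisionRing K] [AddCommGroup V] [Module K V]
    {W S : Submodule K V} {v w : V} (hW : W ≤ K ∙ v) (hwW : w ∈ W) (hwS : w ∈ S) (hw : w ≠ 0) :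
    W ≤ S := by
  obtain ⟨t, ht⟩ := Submodule.mem_span_singleton.mp (hW hwW)
  have ht0 : t ≠ 0 := by
    rintro rfl
    exact hw (by rw [← ht, zero_smul])
  have hv : v ∈ S := by
    rw [show v = t⁻¹ • w by rw [← ht, smul_smul, inv_mul_cancel₀ ht0, one_smul]]
    exact S.smul_mem _ hwS
  intro x hx
  obtain ⟨s, hs⟩ := Submodule.mem_span_singleton.mp (hW hx)
  rw [← hs]
  exact S.smul_mem _ hv

/-- **"If `ω_α(Z) ≠ 0` for an algebraic cycle `Z`, then claim(α) is true"** (Aoki p. 386) in the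
tree's cycle-map-free language, granted that `V(α)` is at most a line (`dim V(α) = 1`, Ran Prop. 1.7
(i); hypothesis `hdim`, in the form of the tree's `FermatCharacter.claim_of_represents` of
`FermatInductiveClaimsProofs`, which is the same statement for a class in `algebraicClasses`): if a
class `c ∈ H²ʳ(X²ʳₘ(ℂ); ℂ)` SUPPORTED ON a Zariski-closed `Z ⊆ X²ʳₘ` all of whose points have
codimension `≥ r` (i.e. `c|_{(X ∖ Z)(ℂ)} = 0`; for `Z` irreducible of codimension `r` these are the
multiples of the cycle class `cl(Z)`, module docstring of `AlgebraicClasses`) has `π_α c ≠ 0`, then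
`V(α)` consists of algebraic classes: `c` is algebraic by definition of `algebraicClasses = Nʳ H²ʳ`
(`mem_supportedClasses_of_restrictCompl_eq_zero`), so is `π_α c ∈ V(α)` (`π_α` is a combination of
pull-backs along the automorphisms `[x] ↦ [a • x]`, `eigenProjector_mem_algebraicClasses`), and
`V(α) ⊆ ℂ ∙ v` meets `algebraicClasses` in `π_α c ≠ 0` (`Submodule.le_of_le_span_singleton`); `r = 0`
is `claim_zero`. [cite: Aoki1987, p. 386] [cite: Shioda1979PJA, §4] -/
theorem FermatCharacter.claim_of_supportedClass [NeZero m] {α : Fin (2 * r + 2) → ZMod m}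
    (hdim : ∃ v, fermatEigenspace m α (2 * r) ≤ ℂ ∙ v)
    {Z : Set (fermatHypersurface (2 * r) m).left} (hZ : IsClosed Z)
    (hcodim : ∀ z ∈ Z, (r : ℕ∞) ≤ Order.coheight z)
    {c : complexBetti (fermatHypersurface (2 * r) m) (2 * r)}
    (hc : complexBetti.restrictCompl (fermatHypersurface (2 * r) m) Z (2 * r) c = 0)
    (hα : fermatProjector m α (2 * r) c ≠ 0) : FermatCharacter.Claim m r α := by
  rcases Nat.eq_zero_or_pos r with rfl | hr
  · exact FermatCharacter.claim_zero m α
  obtain ⟨v, hv⟩ := hdim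
  have hX : IsSmoothProjective (2 * r) (fermatHypersurface (2 * r) m) :=
    isSmoothProjective_fermatHypersurface (by omega) NeZero.one_le
  exact Submodule.le_of_le_span_singleton hv (fermatProjector_mem α c)
    (eigenProjector_mem_algebraicClasses (fermatPolynomial ℂ (2 * r) m)
      (fermatGroup_le_diagonalStabilizer m) (fermatCharacter m α) hX
      (mem_supportedClasses_of_restrictCompl_eq_zero hZ hcodim hc)) hα

/-- A paired character with non-zero coordinates is admissible (`Σ δᵢ = 0`: the pairs cancel).
[cite: Ran1980, §1 (1.8)] -/
theorem FermatCharacter.IsPaired.isAdmissible [NeZero m] {k : ℕ} {δ : Fin k → ZMod m}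
    (h : FermatCharacter.IsPaired δ) (hδ : ∀ i, δ i ≠ 0) : FermatCharacter.IsAdmissible δ :=
  (h.isHodge hδ).1

/-! ### `Shioda_claim_paired` from Thm. 1-1 ("`L` represents `δ`") and `dim V(δ) ≤ 1` -/

/-- **`Shioda_claim_paired` from its two printed inputs.** Granted, for every paired character
`δ` of `X²ʳₘ` with all `δᵢ ≠ 0` (`r ≥ 1`, `m ≥ 1`):
(A) `hE1`: `V(α)` is at most a line for `α ∈ 𝔄²ʳₘ` (Ran Prop. 1.7 (i); the hypothesis of
`FermatCharacter.claim_of_represents` and of `Aoki1987_claim_pStandard_of_represents`), and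
(B) THEOREM 1-1 as printed — an algebraic cycle represents `δ`: there are a Zariski-closed
`Z ⊆ X²ʳₘ` of codimension `≥ r` pointwise (the linear space `L : x_{2i} + ε x_{2i+1} = 0` with the
coordinates permuted along the pairing of `δ`) and a class supported on `Z` with non-zero
`δ`-component (`ω_δ(L) ≠ 0`),
the fact `Shioda_claim_paired` follows (`claim_of_supportedClass`; `r = 0` is `claim_zero`).
[cite: Aoki1987, Thm. 1-1 and p. 386] [cite: Ran1980, §1 Prop. 1.7 (i), Prop. 1.14 and Thm. 4.9] -/
theorem Shioda_claim_paired_of_represents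
    (hE1 : ∀ (m r : ℕ) [NeZero m] (α : Fin (2 * r + 2) → ZMod m), 0 < r →
      FermatCharacter.IsAdmissible α → ∃ v, fermatEigenspace m α (2 * r) ≤ ℂ ∙ v)
    (hB : ∀ (m r : ℕ) [NeZero m] (δ : Fin (2 * r + 2) → ZMod m), 0 < r → (∀ i, δ i ≠ 0) →
      FermatCharacter.IsPaired δ →
      ∃ Z : Set (fermatHypersurface (2 * r) m).left, IsClosed Z ∧
        (∀ z ∈ Z, (r : ℕ∞) ≤ Order.coheight z) ∧
        ∃ c : complexBetti (fermatHypersurface (2 * r) m) (2 * r),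
          complexBetti.restrictCompl (fermatHypersurface (2 * r) m) Z (2 * r) c = 0 ∧
          fermatProjector m δ (2 * r) c ≠ 0) :
    Shioda_claim_paired := by
  intro m r _ δ hδ hpair
  rcases Nat.eq_zero_or_pos r with rfl | hr
  · exact FermatCharacter.claim_zero m δ
  obtain ⟨Z, hZ, hcodim, c, hc, hne⟩ := hB m r δ hr hδ hpair
  exact FermatCharacter.claim_of_supportedClass (hE1 m r δ hr (hpair.isAdmissible hδ)) hZ hcodim hc hne

/-! ### Closed immersions and the dimension of points -/

/-- The underlying map of a closed immersion of schemes is strictly monotone for the specialisation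
orders (`a ≤ b ↔ b ⤳ a`): it is a topological embedding, so it preserves AND reflects
specialisation (`Topology.IsInducing.specializes_iff`). [folklore] -/
theorem strictMono_base_of_isClosedImmersion {X Y : Scheme} (f : X ⟶ Y) [IsClosedImmersion f] :
    StrictMono f.base := by
  have hf := f.isClosedEmbedding.isInducing
  intro a b hab
  rw [lt_iff_le_not_ge, Scheme.le_iff_specializes, Scheme.le_iff_specializes] at hab ⊢
  exact ⟨hab.1.map f.continuous, fun h ↦ hab.2 (hf.specializes_iff.mp h)⟩

/-- Along a closed immersion the dimension `height z = dim {z}⁻` of a point can only grow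
(chains of specialisations below `z` embed). [folklore] -/
theorem height_le_height_base_of_isClosedImmersion {X Y : Scheme} (f : X ⟶ Y) [IsClosedImmersion f]
    (z : X) : Order.height z ≤ Order.height (f.base z) :=
  Order.height_le_height_apply_of_strictMono _ (strictMono_base_of_isClosedImmersion f) z

/-! ### Linear sections of an embedded smooth projective variety have the expected codimension bound -/

section LinearSection

attribute [local instance] MvPolynomial.gradedAlgebra

variable {N d t : ℕ} {Y : Motives.SchemeOver ℂ}

/-- **A linear section by `t` independent forms has codimension `≥ d + t - N` pointwise.** Let `Y`
be smooth projective of dimension `d` over `ℂ` with a CLOSED IMMERSION `ι : Y ↪ ℙᴺ_ℂ`, and let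
`L₁, …, L_t` (`t ≤ N`) be linearly independent linear forms. Every point `z ∈ Y` with
`ι(z) ∈ V₊(L₁, …, L_t)` has `coheight z + (N - t) ≥ d`, i.e. codimension `≥ d - (N - t)` in `Y`:
`ι(z)` specialises from the generic point `ℓ` of the linear subspace, of dimension `N - t`
(`Motives.exists_point_of_linearIndependent`, Hartshorne I Ex. 2.11), so
`dim {z}⁻ = height z ≤ height ι(z) ≤ N - t`, and `height z + coheight z = d` on the smooth
irreducible `Y` (`Motives.height_add_coheight_eq_of_smoothOfRelativeDimension`, Hartshorne II
Ex. 3.20). [cite: Hartshorne1977, I Ex. 2.11 and II Ex. 3.20] -/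
theorem le_coheight_add_of_mem_zeroLocus_linearForms (hY : IsSmoothProjective d Y)
    (ι : Y ⟶ projectiveSpace N ℂ) [IsClosedImmersion ι.left]
    (L : Fin t → MvPolynomial (Fin (N + 1)) ℂ) (hL : LinearIndependent ℂ L)
    (hhom : ∀ j, (L j).IsHomogeneous 1) (ht : t ≤ N) {z : Y.left}
    (hz : ι.left.base z ∈ ProjectiveSpectrum.zeroLocus (MvPolynomial.homogeneousSubmodule (Fin (N + 1)) ℂ)
      (Set.range L)) :
    (d : ℕ∞) ≤ Order.coheight z + ((N - t : ℕ) : ℕ∞) := by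
  obtain ⟨ℓ, hℓI, hℓh, -⟩ := exists_point_of_linearIndependent L hL hhom ht
  -- `ι z ≤ ℓ`: the homogeneous prime of `ι z` contains the `L_j`, hence the prime `(L₁, …, L_t)` of `ℓ`
  have h1 : ι.left.base z ≤ ℓ := by
    rw [projectiveSpace_le_iff]
    change (ProjectiveSpectrum.asHomogeneousIdeal
        (𝒜 := MvPolynomial.homogeneousSubmodule (Fin (N + 1)) ℂ) ℓ).toIdeal ≤
      (ProjectiveSpectrum.asHomogeneousIdeal
        (𝒜 := MvPolynomial.homogeneousSubmodule (Fin (N + 1)) ℂ) (ι.left.base z)).toIdeal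
    rw [hℓI, Ideal.span_le]
    exact hz
  have h2 : Order.height (ι.left.base z) ≤ ((N - t : ℕ) : ℕ∞) := hℓh ▸ Order.height_mono h1
  have h3 : Order.height z ≤ ((N - t : ℕ) : ℕ∞) :=
    (height_le_height_base_of_isClosedImmersion ι.left z).trans h2
  haveI := hY.smoothOfRelativeDimension
  haveI := hY.geometricallyIrreducible
  haveI : IrreducibleSpace ↥Y.left := GeometricallyIrreducible.irreducibleSpace_of_subsingleton Y.hom
  have hsum : Order.height z + Order.coheight z = d :=
    Motives.height_add_coheight_eq_of_smoothOfRelativeDimension Y.hom d z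
  calc (d : ℕ∞) = Order.height z + Order.coheight z := hsum.symm
    _ ≤ ((N - t : ℕ) : ℕ∞) + Order.coheight z := add_le_add h3 le_rfl
    _ = Order.coheight z + ((N - t : ℕ) : ℕ∞) := add_comm _ _

end LinearSection

/-! ### The standard linear subspaces `L_{σ,ε} : xᵢ = εᵢ x_{σ i}` and their traces on `Xⁿₘ` -/

section PairedLinearSubspace

attribute [local instance] MvPolynomial.gradedAlgebra

/-- The grading of `ℂ[x₀, …, x_{n+1}]` by degree (`ℙⁿ⁺¹_ℂ = Proj 𝓐`). -/
local notation "𝓐" => MvPolynomial.homogeneousSubmodule (Fin (n + 2)) ℂ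

/-- The linear forms `xᵢ - εᵢ x_{σ(i)}` attached to a permutation `σ` of the homogeneous coordinates
of `ℙⁿ⁺¹` and scalars `ε` (Shioda's `x_{2i} + ε x_{2i+1}` for `σ = (01)(23)⋯`, `εᵢ = -ε`; Ran's lines
`X₀ = εζⁱX₁, X₂ = εζʲX₃` on `V²ₘ`). [cite: Aoki1987, Thm. 1-1] [cite: Ran1980, §1 Prop. 1.14] -/
def pairedLinearForm (σ : Equiv.Perm (Fin (n + 2))) (ε : Fin (n + 2) → ℂ) (i : Fin (n + 2)) :
    MvPolynomial (Fin (n + 2)) ℂ :=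
  X i - C (ε i) * X (σ i)

/-- `xᵢ - εᵢ x_{σ i}` is a linear form. [folklore] -/
theorem isHomogeneous_pairedLinearForm (σ : Equiv.Perm (Fin (n + 2))) (ε : Fin (n + 2) → ℂ)
    (i : Fin (n + 2)) : (pairedLinearForm σ ε i).IsHomogeneous 1 :=
  (isHomogeneous_X ℂ i).sub (isHomogeneous_C_mul_X (ε i) (σ i))

/-- **The linear subspace `L_{σ,ε} = V₊(xᵢ - εᵢ x_{σ i} : i < σ i) ⊆ ℙⁿ⁺¹_ℂ`**, a Zariski-closed
subset of the scheme `ℙⁿ⁺¹_ℂ = Proj ℂ[x₀, …, x_{n+1}]` (one equation for each orbit `{i, σ i}` of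
the pairing, read at its smaller element). For `σ` a fixed-point-free involution of the `2r + 2`
coordinates of `ℙ²ʳ⁺¹` this is an `r`-plane, and it lies on `X²ʳₘ` when `εᵢᵐ = -1`.
[cite: Aoki1987, Thm. 1-1 (the linear space L)] [cite: Ran1980, Thm. 4.9] -/
def pairedLinearSubspace (σ : Equiv.Perm (Fin (n + 2))) (ε : Fin (n + 2) → ℂ) :
    Set ↥(projectiveSpace (n + 1) ℂ).left :=
  ProjectiveSpectrum.zeroLocus 𝓐 (pairedLinearForm σ ε '' {i | i < σ i})

/-- `L_{σ,ε}` is Zariski-closed. [folklore] -/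
theorem isClosed_pairedLinearSubspace (σ : Equiv.Perm (Fin (n + 2))) (ε : Fin (n + 2) → ℂ) :
    IsClosed (pairedLinearSubspace σ ε) :=
  ProjectiveSpectrum.isClosed_zeroLocus 𝓐 _

variable (m) in
/-- **The trace `Z_{σ,ε} = Xⁿₘ ∩ L_{σ,ε}`** of the linear subspace on the standard model of the
Fermat variety: the preimage of `L_{σ,ε}` under the closed immersion `Xⁿₘ ↪ ℙⁿ⁺¹`, a Zariski-closed
subset of the scheme `Xⁿₘ` (equal to `L_{σ,ε}` itself when `εᵢᵐ = -1`, since then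
`xᵢᵐ + x_{σ i}ᵐ = (εᵢᵐ + 1) x_{σ i}ᵐ = 0` on `L`). [cite: Aoki1987, Thm. 1-1] -/
def fermatLinearSection (σ : Equiv.Perm (Fin (n + 2))) (ε : Fin (n + 2) → ℂ) :
    Set ↥(fermatHypersurface n m).left :=
  (SmoothHypersurface.hypersurfaceι (fermatPolynomial ℂ n m)).left.base ⁻¹' pairedLinearSubspace σ ε

/-- `Z_{σ,ε} ⊆ Xⁿₘ` is Zariski-closed. [folklore] -/
theorem isClosed_fermatLinearSection (σ : Equiv.Perm (Fin (n + 2))) (ε : Fin (n + 2) → ℂ) :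
    IsClosed (fermatLinearSection m σ ε) :=
  (isClosed_pairedLinearSubspace σ ε).preimage (SmoothHypersurface.hypersurfaceι _).left.continuous

/-- For a fixed-point-free involution `σ`, an index `i` with `i < σ i` is sent to one with
`σ i > σ (σ i)`: the smaller elements of the orbits are never images of smaller elements. [folklore] -/
theorem not_lt_perm_perm {σ : Equiv.Perm (Fin (n + 2))} (h2 : ∀ i, σ (σ i) = i) {i : Fin (n + 2)}
    (hi : i < σ i) : ¬ σ i < σ (σ i) := by
  rw [h2]; exact lt_asymm hi

/-- **A fixed-point-free involution of `2r + 2` letters has exactly `r + 1` orbits**: the smaller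
elements `{i | i < σ i}` of the orbits are equinumerous (via `σ`) with the larger ones
`{i | σ i < i}`, and together they exhaust the letters. [folklore] -/
theorem card_filter_lt_perm {σ : Equiv.Perm (Fin (2 * r + 2))} (h1 : ∀ i, σ i ≠ i)
    (h2 : ∀ i, σ (σ i) = i) : #{i | i < σ i} = r + 1 := by
  have hST : #{i | i < σ i} = #(({i | i < σ i} : Finset (Fin (2 * r + 2)))ᶜ) := by
    refine Finset.card_bij (fun i _ ↦ σ i) (fun i hi ↦ ?_) (fun i _ j _ h ↦ σ.injective h)
      (fun j hj ↦ ⟨σ j, ?_, h2 j⟩)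
    · simp only [mem_compl, mem_filter, mem_univ, true_and] at hi ⊢
      exact not_lt_perm_perm h2 hi
    · simp only [mem_compl, mem_filter, mem_univ, true_and] at hj ⊢
      rw [h2]
      exact lt_of_le_of_ne (not_lt.mp hj) (h1 j)
  have hsum := Finset.card_add_card_compl ({i | i < σ i} : Finset (Fin (2 * r + 2)))
  rw [Fintype.card_fin, ← hST] at hsum
  omega

/-- **`Z_{σ,ε} ⊆ X²ʳₘ` has codimension `≥ r` at every point** (`m ≥ 1`, `σ` a fixed-point-free
involution of the `2r + 2` coordinates): the `r + 1` linear forms `xᵢ - εᵢ x_{σ i}`, `i < σ i`, are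
linearly independent (substituting `x_j ↦ 0` for the larger elements `j` of the orbits sends them
to the distinct variables `xᵢ`), so `L_{σ,ε}` is an `r`-plane of `ℙ²ʳ⁺¹` and its trace on the
smooth `2r`-fold `X²ʳₘ` has codimension `≥ 2r - r = r` pointwise
(`le_coheight_add_of_mem_zeroLocus_linearForms`). This is the "codimension `r`" half of "the
linear space `L` represents `δ`". [cite: Aoki1987, Thm. 1-1] [cite: Hartshorne1977, I Ex. 2.11] -/
theorem le_coheight_of_mem_fermatLinearSection (hm : 1 ≤ m) {σ : Equiv.Perm (Fin (2 * r + 2))}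
    (h1 : ∀ i, σ i ≠ i) (h2 : ∀ i, σ (σ i) = i) (ε : Fin (2 * r + 2) → ℂ)
    {z : ↥(fermatHypersurface (2 * r) m).left} (hz : z ∈ fermatLinearSection m σ ε) :
    (r : ℕ∞) ≤ Order.coheight z := by
  classical
  rcases Nat.eq_zero_or_pos r with rfl | hr
  · simp
  -- enumerate the smaller elements of the orbits
  obtain ⟨e, heS⟩ : ∃ e : Fin (r + 1) ↪ Fin (2 * r + 2), ∀ j, e j < σ (e j) := by
    have hcard : #{i | i < σ i} = r + 1 := card_filter_lt_perm h1 h2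
    refine ⟨(Finset.orderEmbOfFin _ hcard).toEmbedding, fun j ↦ ?_⟩
    have h := Finset.orderEmbOfFin_mem ({i | i < σ i} : Finset (Fin (2 * r + 2))) hcard j
    rw [mem_filter] at h
    exact h.2
  -- the `r + 1` forms and their independence
  set L : Fin (r + 1) → MvPolynomial (Fin (2 * r + 2)) ℂ := fun j ↦ pairedLinearForm σ ε (e j) with hL
  have hLind : LinearIndependent ℂ L := by
    let φ : MvPolynomial (Fin (2 * r + 2)) ℂ →ₐ[ℂ] MvPolynomial (Fin (2 * r + 2)) ℂ :=
      aeval fun i ↦ if i < σ i then X i else 0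
    have hφL : φ.toLinearMap ∘ L = fun j ↦ X (e j) := by
      funext j
      simp only [Function.comp_apply, AlgHom.toLinearMap_apply, hL, pairedLinearForm, map_sub,
        map_mul, aeval_C, aeval_X, φ, if_pos (heS j), if_neg (not_lt_perm_perm h2 (heS j)),
        mul_zero, sub_zero]
    refine LinearIndependent.of_comp φ.toLinearMap ?_
    rw [hφL]
    exact (linearIndependent_X (Fin (2 * r + 2)) ℂ).comp _ e.injective
  have hX : IsSmoothProjective (2 * r) (fermatHypersurface (2 * r) m) :=
    isSmoothProjective_fermatHypersurface (by omega) hm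
  have hz' : (SmoothHypersurface.hypersurfaceι (fermatPolynomial ℂ (2 * r) m)).left.base z ∈
      ProjectiveSpectrum.zeroLocus (MvPolynomial.homogeneousSubmodule (Fin (2 * r + 1 + 1)) ℂ)
        (Set.range L) := by
    intro f hf
    obtain ⟨j, rfl⟩ := hf
    exact hz ⟨e j, heS j, rfl⟩
  have key := le_coheight_add_of_mem_zeroLocus_linearForms (N := 2 * r + 1) (t := r + 1) hX
    (SmoothHypersurface.hypersurfaceι (fermatPolynomial ℂ (2 * r) m)) L hLind
    (fun j ↦ isHomogeneous_pairedLinearForm σ ε (e j)) (by omega) hz'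
  have hsub : 2 * r + 1 - (r + 1) = r := by omega
  rw [hsub] at key
  -- `2r ≤ coheight z + r`
  by_contra hlt
  push Not at hlt
  have hfin : Order.coheight z ≠ ⊤ := (hlt.trans (ENat.coe_lt_top r)).ne
  obtain ⟨c, hc⟩ := ENat.ne_top_iff_exists.mp hfin
  rw [← hc] at key hlt
  have h1' : (2 * r : ℕ) ≤ c + r := by exact_mod_cast key
  have h2' : c < r := by exact_mod_cast hlt
  omega

/-- **`Shioda_claim_paired` from Thm. 1-1 in its printed form.** Granted, for every `r ≥ 1`,
`m ≥ 1` and every character `δ` of `X²ʳₘ` with all `δᵢ ≠ 0` paired by a fixed-point-free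
involution `σ` (`δ (σ i) = -δ i`):
(A) `hE1`: `V(α)` is at most a line for `α ∈ 𝔄²ʳₘ` (Ran Prop. 1.7 (i)), and
(B2) THEOREM 1-1 (Shioda) — "the linear space `L` represents `δ`": for some scalars `ε` (in print
`εᵢᵐ = -1`, so that `L_{σ,ε} ⊆ X²ʳₘ`) some class supported on `Z_{σ,ε} = X²ʳₘ ∩ L_{σ,ε}` (i.e.
vanishing on `(X ∖ Z)(ℂ)`; classically the multiples of `cl(L)`) has a non-zero `δ`-component
`π_δ` (`ω_δ(L) ≠ 0`),
the named fact `Shioda_claim_paired` holds: `Z_{σ,ε}` is Zariski-closed of codimension `≥ r`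
pointwise (`le_coheight_of_mem_fermatLinearSection`), so "represents ⟹ claim"
(`FermatCharacter.claim_of_supportedClass`) applies. [cite: Aoki1987, Thm. 1-1 and p. 386]
[cite: Ran1980, §1 Prop. 1.7 (i), Prop. 1.14 and Thm. 4.9] -/
theorem Shioda_claim_paired_of_linearSubspace_represents
    (hE1 : ∀ (m r : ℕ) [NeZero m] (α : Fin (2 * r + 2) → ZMod m), 0 < r →
      FermatCharacter.IsAdmissible α → ∃ v, fermatEigenspace m α (2 * r) ≤ ℂ ∙ v)
    (hB : ∀ (m r : ℕ) [NeZero m] (δ : Fin (2 * r + 2) → ZMod m) (σ : Equiv.Perm (Fin (2 * r + 2))),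
      0 < r → (∀ i, δ i ≠ 0) → (∀ i, σ i ≠ i) → (∀ i, σ (σ i) = i) → (∀ i, δ (σ i) = -δ i) →
      ∃ (ε : Fin (2 * r + 2) → ℂ) (c : complexBetti (fermatHypersurface (2 * r) m) (2 * r)),
        complexBetti.restrictCompl (fermatHypersurface (2 * r) m) (fermatLinearSection m σ ε) (2 * r) c = 0 ∧
        fermatProjector m δ (2 * r) c ≠ 0) :
    Shioda_claim_paired := by
  refine Shioda_claim_paired_of_represents hE1 fun m r _ δ hr hδ hpair ↦ ?_
  obtain ⟨σ, h1, h2, hδσ⟩ := hpair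
  obtain ⟨ε, c, hc, hne⟩ := hB m r δ σ hr hδ h1 h2 hδσ
  exact ⟨fermatLinearSection m σ ε, isClosed_fermatLinearSection σ ε,
    fun z hz ↦ le_coheight_of_mem_fermatLinearSection NeZero.one_le h1 h2 ε hz, c, hc, hne⟩

end PairedLinearSubspace

end Literature.AlgebraicGeometry.HodgeTheory

end
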